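import Summits.HubbardSuperconductivity.HubbardSuperconductivity.Theorems.AnisotropyChordTransferFibre3OneLoopCross
import Summits.HubbardSuperconductivity.HubbardSuperconductivity.Theorems.AnisotropyChordTransferFibre3TauTailBound
import Summits.HubbardSuperconductivity.HubbardSuperconductivity.Theorems.AnisotropyChordTransferFibre3PoleCount

/-!
# Route `AnisotropyChord` / H0 rotor rung: the `δ₃` bound — `|T⁺ − 3λ₂|·‖Π⁰‖² ≤ (3/2)·Σf²·Σ_e ‖f·D_e f‖²` (Level 1)

`T⁺ = 3λ₂(1 + δ₃)` (memo 20 §269/§272, memo 21 §297; theory seat `hubbard-h0-rotor-theory-1`).  From the two tree identities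
`⟨Π⁰, C0⟩ = (T⁺ − 3λ₂)‖Π⁰‖²` (`sum_piR_C0fn`, `…Fibre3C0Layer`) and `⟨Π⁰, C0⟩ = −(3/2) Σ_e (1/V) Σ_k |φ̂_e(k)|² F₂(k)`
(`piC0OneLoop_holds`, `…Fibre3OneLoopCross`), the domination of the Fourier transform of the non-negative function `f²`
by its zero mode (`abs_re_dft_le_sum`, `…Fibre3TauTailBound`: `|F₂(k)| ≤ Σ_r f(r)²`) and Parseval
(`normSq_dft_sum`: `Σ_k |φ̂_e(k)|² = V Σ_r (f·D_e f)(r)²`) give the LEVEL-1 estimate of the regime quantity `T⁺`: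
**`abs_Tplus_sub_mul_le`**: `|(T⁺ − 3λ₂)·‖Π⁰‖²| ≤ (3/2)·(Σ_r f²)·Σ_{e=±eₓ,±e_y} Σ_r (f·D_e f)²`, and the two-sided
consequences `Tplus_le_of_delta3`, `le_Tplus_of_delta3` (for `‖Π⁰‖² > 0`).  The regime facts `T⁺ < 2ε₁`, `mHole ≥ 0` of the
GM₃ assembly then follow from Level-2 size bounds on `λ₂`, `Σf²`, `‖D_e f‖²`, `‖Π⁰‖²` (theory, LEVEL2-SPEC).
Prover seat `hubbard-h0-rotor-p1` g23; helper for stmt-HubbardSuperconductivity-19089 (`--supports`).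
-/

set_option linter.dupNamespace false
set_option autoImplicit false

noncomputable section

open scoped BigOperators
open Complex

namespace Summit.HubbardSuperconductivity.HubbardSuperconductivity.Theorems.AnisotropyChord.Transfer.Fibre3

variable (L : ℕ) [NeZero L]

/-- **Parseval for a real function:** `Σ_k |ĝ(k)|² = V·Σ_r g(r)²`. [folklore] -/
theorem normSq_dft_sum (u : Tor L → ℝ) :
    ∑ k : Tor L, Complex.normSq (dft L u k) = (L : ℝ) ^ 2 * ∑ r : Tor L, u r ^ 2 := by
  have h := parseval1D L (fun r => (u r : ℂ))
  have e1 : ∀ k : Tor L, Complex.normSq (dft L u k) = ‖∑ b : Tor L, (starRingEnd ℂ) (phase L k b) * (u b : ℂ)‖ ^ 2 := by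
    intro k; rw [Complex.normSq_eq_norm_sq]; rfl
  have e2 : ∀ r : Tor L, u r ^ 2 = ‖(u r : ℂ)‖ ^ 2 := by
    intro r; rw [Complex.norm_real, Real.norm_eq_abs, sq_abs]
  simp_rw [e1, e2]
  exact h

/-- the one-loop number `X_e = Σ_k |φ̂_e(k)|² F₂(k)` is dominated by `Σf² · V · Σ_r (f·D_e f)²`. [folklore] -/
theorem abs_sum_normSq_phiHat_F2_le (f : Tor L → ℝ) (e : Tor L) :
    |∑ k : Tor L, Complex.normSq (phiHat L f e k) * F2 L f k|
      ≤ (∑ r : Tor L, f r ^ 2) * ((L : ℝ) ^ 2 * ∑ r : Tor L, (f r * Dgrad L f e r) ^ 2) := by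
  have hF : ∀ k : Tor L, |F2 L f k| ≤ ∑ r : Tor L, f r ^ 2 := fun k =>
    abs_re_dft_le_sum L (g := fun r => f r ^ 2) (fun r => sq_nonneg (f r)) k
  have hP : ∑ k : Tor L, Complex.normSq (phiHat L f e k) = (L : ℝ) ^ 2 * ∑ r : Tor L, (f r * Dgrad L f e r) ^ 2 := by
    unfold phiHat; exact normSq_dft_sum L (fun r => f r * Dgrad L f e r)
  calc |∑ k : Tor L, Complex.normSq (phiHat L f e k) * F2 L f k|
      ≤ ∑ k : Tor L, |Complex.normSq (phiHat L f e k) * F2 L f k| := Finset.abs_sum_le_sum_abs _ _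
    _ ≤ ∑ k : Tor L, Complex.normSq (phiHat L f e k) * ∑ r : Tor L, f r ^ 2 := by
        refine Finset.sum_le_sum fun k _ => ?_
        rw [abs_mul, abs_of_nonneg (Complex.normSq_nonneg _)]
        exact mul_le_mul_of_nonneg_left (hF k) (Complex.normSq_nonneg _)
    _ = (∑ r : Tor L, f r ^ 2) * ((L : ℝ) ^ 2 * ∑ r : Tor L, (f r * Dgrad L f e r) ^ 2) := by
        rw [← Finset.sum_mul, hP]; ring

/-- ★ **the `δ₃` bound (Level 1):** `|(T⁺ − 3λ₂)·‖Π⁰‖²| ≤ (3/2)·(Σ_r f(r)²)·Σ_{e} Σ_r (f·D_e f)(r)²`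
for a two-magnon eigenfunction `f` that is even. [folklore] -/
theorem abs_Tplus_sub_mul_le {Δ lam2 : ℝ} {f : Tor L → ℝ} (hf : IsTwoMagnon L Δ lam2 f)
    (hev : ∀ r : Tor L, f (-r) = f r) :
    |(Tplus L Δ f - 3 * lam2) * PiNormSq L f|
      ≤ (3 / 2) * (∑ r : Tor L, f r ^ 2)
          * ((nnList L).map (fun e => ∑ r : Tor L, (f r * Dgrad L f e r) ^ 2)).sum := by
  have hL0 : (0 : ℝ) < (L : ℝ) ^ 2 := by
    have : (0 : ℝ) < L := by exact_mod_cast Nat.pos_of_ne_zero (NeZero.ne L)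
    positivity
  rw [← sum_piR_C0fn L hf, piC0OneLoop_holds L Δ lam2 f hf hev, nnList_map_sum, nnList_map_sum, abs_mul,
    show |(-(3 / 2) : ℝ)| = 3 / 2 by norm_num, mul_assoc]
  refine mul_le_mul_of_nonneg_left ?_ (by norm_num)
  -- per direction
  have hdir : ∀ e : Tor L, |(∑ k : Tor L, Complex.normSq (phiHat L f e k) * F2 L f k) / (L : ℝ) ^ 2|
      ≤ (∑ r : Tor L, f r ^ 2) * ∑ r : Tor L, (f r * Dgrad L f e r) ^ 2 := by
    intro e
    rw [abs_div, abs_of_pos hL0, div_le_iff₀ hL0]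
    calc |∑ k : Tor L, Complex.normSq (phiHat L f e k) * F2 L f k|
        ≤ (∑ r : Tor L, f r ^ 2) * ((L : ℝ) ^ 2 * ∑ r : Tor L, (f r * Dgrad L f e r) ^ 2) :=
          abs_sum_normSq_phiHat_F2_le L f e
      _ = (∑ r : Tor L, f r ^ 2) * (∑ r : Tor L, (f r * Dgrad L f e r) ^ 2) * (L : ℝ) ^ 2 := by ring
  have h1 := hdir (ex L); have h2 := hdir (-ex L); have h3 := hdir (ey L); have h4 := hdir (-ey L)
  calc |(∑ k : Tor L, Complex.normSq (phiHat L f (ex L) k) * F2 L f k) / (L : ℝ) ^ 2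
        + (∑ k : Tor L, Complex.normSq (phiHat L f (-ex L) k) * F2 L f k) / (L : ℝ) ^ 2
        + (∑ k : Tor L, Complex.normSq (phiHat L f (ey L) k) * F2 L f k) / (L : ℝ) ^ 2
        + (∑ k : Tor L, Complex.normSq (phiHat L f (-ey L) k) * F2 L f k) / (L : ℝ) ^ 2|
      ≤ |(∑ k : Tor L, Complex.normSq (phiHat L f (ex L) k) * F2 L f k) / (L : ℝ) ^ 2|
        + |(∑ k : Tor L, Complex.normSq (phiHat L f (-ex L) k) * F2 L f k) / (L : ℝ) ^ 2|
        + |(∑ k : Tor L, Complex.normSq (phiHat L f (ey L) k) * F2 L f k) / (L : ℝ) ^ 2|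
        + |(∑ k : Tor L, Complex.normSq (phiHat L f (-ey L) k) * F2 L f k) / (L : ℝ) ^ 2| := by
          refine (abs_add_le _ _).trans ?_
          refine add_le_add ((abs_add_le _ _).trans (add_le_add ((abs_add_le _ _)) le_rfl)) le_rfl
    _ ≤ _ := by
          rw [mul_add, mul_add, mul_add]
          linarith

/-- **upper regime bound:** `T⁺ ≤ 3λ₂ + (3/2)·Σf²·Σ_e‖f·D_e f‖² / ‖Π⁰‖²` (`‖Π⁰‖² > 0`). [folklore] -/
theorem Tplus_le_of_delta3 {Δ lam2 : ℝ} {f : Tor L → ℝ} (hf : IsTwoMagnon L Δ lam2 f)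
    (hev : ∀ r : Tor L, f (-r) = f r) (hP : 0 < PiNormSq L f) :
    Tplus L Δ f ≤ 3 * lam2 + (3 / 2) * (∑ r : Tor L, f r ^ 2)
      * ((nnList L).map (fun e => ∑ r : Tor L, (f r * Dgrad L f e r) ^ 2)).sum / PiNormSq L f := by
  have h := abs_Tplus_sub_mul_le L hf hev
  have h1 : (Tplus L Δ f - 3 * lam2) * PiNormSq L f ≤ (3 / 2) * (∑ r : Tor L, f r ^ 2)
      * ((nnList L).map (fun e => ∑ r : Tor L, (f r * Dgrad L f e r) ^ 2)).sum := (le_abs_self _).trans h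
  rw [add_div' _ _ _ hP.ne', le_div_iff₀ hP]
  linarith

/-- **lower regime bound:** `3λ₂ − (3/2)·Σf²·Σ_e‖f·D_e f‖² / ‖Π⁰‖² ≤ T⁺` (`‖Π⁰‖² > 0`). [folklore] -/
theorem le_Tplus_of_delta3 {Δ lam2 : ℝ} {f : Tor L → ℝ} (hf : IsTwoMagnon L Δ lam2 f)
    (hev : ∀ r : Tor L, f (-r) = f r) (hP : 0 < PiNormSq L f) :
    3 * lam2 - (3 / 2) * (∑ r : Tor L, f r ^ 2)
      * ((nnList L).map (fun e => ∑ r : Tor L, (f r * Dgrad L f e r) ^ 2)).sum / PiNormSq L f ≤ Tplus L Δ f := by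
  have h := abs_Tplus_sub_mul_le L hf hev
  have h1 : -((3 / 2) * (∑ r : Tor L, f r ^ 2)
      * ((nnList L).map (fun e => ∑ r : Tor L, (f r * Dgrad L f e r) ^ 2)).sum)
      ≤ (Tplus L Δ f - 3 * lam2) * PiNormSq L f := (neg_abs_le _).trans' (neg_le_neg h)
  rw [sub_div' hP.ne', div_le_iff₀ hP]
  linarith

end Summit.HubbardSuperconductivity.HubbardSuperconductivity.Theorems.AnisotropyChord.Transfer.Fibre3

end
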